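import Summits.QuantumFields.QCD.Theses.OverlapPositivityTransfer
import Literature.MathematicalPhysics.QuantumFieldTheory.OverlapQCDOSDirac
import HarnessLib

/-!
# Route `OverlapPositivityTransfer` (QCD): the support item `OverlapDeterminantPositivity` (stmt-QuantumFields-11154)

POSITIVITY OF THE MASSIVE OVERLAP DETERMINANT, configuration by configuration: for every torus, every `SU(3)` gauge field
`U` off the exceptional set `det(Γ₅ D_W(U,−1,1)) = 0` and every `μ > 0`, `det (qcdOverlapDirac U μ)` is real and strictly
positive.  The item is VERBATIM the conjunction of the tree's Literature theorems `qcdOverlapDirac_det_re_pos` and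
`qcdOverlapDirac_det_im` (`Literature/MathematicalPhysics/QuantumFieldTheory/OverlapQCDOSDirac.lean`, [Neuberger1998, eq. (10)]);
the route file does not import that module, so the closing proof lives here.  Nothing is asserted beyond them; no summit, leg
or crux statement is proved (width seat ym-t4-w17 g0, free hands; the item carried unlanded candidate proofs of 2026-08-15/16
by grounder g21-0 and refuter g44-32 saying exactly this).
-/

set_option autoImplicit false

namespace Summit.QuantumFields.QCD.Theorems

/-- **Item stmt-QuantumFields-11154 `OverlapPositivityTransfer.OverlapDeterminantPositivity` holds.**
[cite: Neuberger1998, eq. (10)] -/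
theorem overlapPositivityTransfer_overlapDeterminantPositivity_proof :
    Summit.QuantumFields.QCD.Theses.OverlapPositivityTransfer.OverlapDeterminantPositivity := by
  unfold Summit.QuantumFields.QCD.Theses.OverlapPositivityTransfer.OverlapDeterminantPositivity
  intro S _ U μ hμ h0
  exact ⟨Literature.MathematicalPhysics.QuantumFieldTheory.qcdOverlapDirac_det_re_pos U hμ h0,
    Literature.MathematicalPhysics.QuantumFieldTheory.qcdOverlapDirac_det_im U μ⟩

end Summit.QuantumFields.QCD.Theorems
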